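import Literature.AlgebraicGeometry.Motives.GaloisDescentScheme
import Literature.AlgebraicGeometry.Motives.ProjectiveDescentProperProofs
import Literature.AlgebraicGeometry.Motives.SymmetricPowerProjective
import Literature.AlgebraicGeometry.Morphisms.ReducedOfFlat
import HarnessLib

/-!
# Effective Galois descent of a DIAGRAM of `L`-schemes: a semilinear `Gal(L/k)`-action on a functor
# `X : J ⥤ SchemeOver L`, natural in `J`, descends it to a functor `X₀ : J ⥤ SchemeOver k`
# (Görtz–Wedhorn I, Thm. 14.83 / Cor. 14.85 object-wise, Thm. 14.72 (1) for the transition maps)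

Let `L / k` be a finite Galois extension and `X : J ⥤ SchemeOver L` a diagram of `L`-schemes (in the application: a tower of
Shimura varieties indexed by the levels `K`).  Suppose every `X j` carries an action `ρ j` of `Gal(L/k)` by `k`-automorphisms
covering `Spec σ⁻¹` on `Spec L` (a SEMILINEAR action, the convention of `GaloisDescent.gal`), the transition maps `X.map f` being
EQUIVARIANT.  Then:

* object-wise, `GaloisDescentScheme.descended` (the quotient `X j / Gal`, Görtz–Wedhorn I Thm. 14.83 / Cor. 14.85, in tree) gives
  `k`-forms `X₀ j` with equivariant identifications `X j ≅ (X₀ j) ×_k Spec L` (`Datum.obj₀`, `Datum.iso`, `aut_hom_iso_hom_left`);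
* the transition maps, transported to `(X₀ i)_L → (X₀ j)_L`, commute with the Galois automorphisms `1 × Spec σ⁻¹` (naturality of
  `ρ`), hence DESCEND uniquely to `k`-morphisms `X₀ i → X₀ j` (`GaloisDescent.descentOver`, Görtz–Wedhorn I Thm. 14.72 (1), in tree;
  `Datum.map₀`, `bcFunctor_map_map₀`, `map₀_unique`);
* uniqueness of descended morphisms (`bcFunctor_map_injective`: base change along `Spec L → Spec k` is faithful) makes `j ↦ X₀ j`
  a FUNCTOR (`Datum.descendedFunctor`) and the identifications a NATURAL isomorphism `X ≅ X₀ ⋙ (· ×_k Spec L)`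
  (`Datum.isoBaseChange`), still equivariant (`aut_hom_isoBaseChange_hom_app_left`).

Packaged without the structure: **`exists_functor_iso`** (the interface pinned by the cell hodgecm-mathlib, row I-6 crew, piece P4:
INPUT the diagram, the actions `ρ`, semilinearity `hρ`, naturality `hnat`, the covering hypothesis `hcov` «every point lies in a
`Gal`-stable affine open», and the three finiteness/regularity hypotheses that the tree's descent of MORPHISMS needs — `X j → Spec L`
locally of finite type and separated, `X j` reduced; OUTPUT `∃ X₀ ι, ∀ j σ, ρ_j σ ≫ ι_j = ι_j ≫ (1 × Spec σ⁻¹)`).  The covering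
hypothesis is discharged for PROJECTIVE `X j` by `cov_of_isProjectiveOver` (finite sets of points lie in affine opens, graded prime
avoidance, in tree).  §1 supplies fpqc descent of `LocallyOfFiniteType` / `IsSeparated` along `Spec L → Spec k` for any `k`-scheme
(the tree's `isProper_of_isProper_baseChange` unbundled), so that the descended objects again satisfy the hypotheses of morphism descent.

Definitions with bodies and theorems only: NO named fact, NO instance, NO `sorry`; net Literature debt 0.  Nothing here refers to
Shimura varieties; HC_CM is not proved here.

## References
* U. Görtz, T. Wedhorn, *Algebraic Geometry I: Schemes*, 2nd ed. (2020): §(14.20), Thm. 14.72 (1) (descent of morphisms),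
  Thm. 14.83 and Cor. 14.85 (Galois descent of quasi-projective schemes), Prop. 14.51 (6), Prop. 14.53 (1), Remark 14.52, Example 14.55
  (fpqc descent of separated / locally of finite type along `Spec L → Spec k`). [GortzWedhorn2020]
* J.-P. Serre, *Local Fields*, GTM 67, Ch. X §2 (Galois descent). [SerreLocalFields1979]
* J. S. Milne, *Jacobian Varieties* (1986), §1, 1.9; §3, proof of Prop. 3.2 (finite sets of points in affine opens). [Milne1986JacobianVarieties]
* Tree: `Motives.GaloisDescentScheme` (`descended`, `isoBaseChangeOver`, `aut_hom_isoBaseChange_hom`, `forall_exists_stableAffineOpen`),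
  `Motives.JacobianGaloisDescent` (`GaloisDescent.gal`, `descentOver`, `bcFunctor_map_descentOver`, `eq_descentOver`),
  `Motives.AbelianVarietyEndGaloisDescent` (`bcFunctor_map_injective`), `Motives.ProjectiveDescentProperProofs`
  (`ProperDescent.fpqc_specMap`, `ProperDescent.isSeparated_of_isSeparated_pullback_fst`), `Motives.SymmetricPowerProjective`
  (`IsProjectiveOver.finiteSubsetsInAffineOpens`), `Motives.GaloisDescentAbelianVariety` (the one-object template).
-/

set_option autoImplicit false

noncomputable section

open CategoryTheory CategoryTheory.Limits AlgebraicGeometry MorphismProperty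
open Literature.AlgebraicGeometry.RelativeSpec

universe v w u

namespace Literature.AlgebraicGeometry.Motives

open AbelianVariety (bcSpec bcFunctor specAut bcFunctor_map_injective)

set_option backward.isDefEq.respectTransparency false

/-! ## §1 fpqc descent of `LocallyOfFiniteType` and `IsSeparated` along `Spec L → Spec k` -/

section DescentOfProperties

variable {k : Type u} [Field k] (L : Type u) [Field L] [Algebra k L] (Y : SchemeOver k)

/-- **`Y → Spec k` is locally of finite type if `Y ×_k Spec L → Spec L` is** (fpqc descent, Görtz–Wedhorn I, Prop. 14.53 (1) with
Remark 14.52 and Example 14.55; Mathlib's `DescendsAlong` instance for `LocallyOfFiniteType`). [cite: GortzWedhorn2020, Prop. 14.53 (1) with Example 14.55] -/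
theorem locallyOfFiniteType_of_baseChange (h : LocallyOfFiniteType ((bcFunctor k L).obj Y).hom) :
    LocallyOfFiniteType Y.hom := by
  change LocallyOfFiniteType (pullback.snd Y.hom (bcSpec k L)) at h
  exact of_pullback_snd_of_descendsAlong (P := @LocallyOfFiniteType)
    (Q := (@Surjective ⊓ @Flat ⊓ @QuasiCompact : MorphismProperty Scheme.{u})) (ProperDescent.fpqc_specMap k L) h

/-- **`Y → Spec k` is separated if `Y ×_k Spec L → Spec L` is** (fpqc descent of separatedness, Görtz–Wedhorn I, Prop. 14.51 (6);
the tree's `ProperDescent.isSeparated_of_isSeparated_pullback_fst`). [cite: GortzWedhorn2020, Prop. 14.51 (6) with Example 14.55] -/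
theorem isSeparated_of_baseChange (h : IsSeparated ((bcFunctor k L).obj Y).hom) : IsSeparated Y.hom := by
  change IsSeparated (pullback.snd Y.hom (bcSpec k L)) at h
  haveI : IsSeparated (pullback.fst (bcSpec k L) Y.hom) := by
    rw [← pullbackSymmetry_hom_comp_snd (bcSpec k L) Y.hom]
    infer_instance
  exact ProperDescent.isSeparated_of_isSeparated_pullback_fst Y.hom (bcSpec k L) (ProperDescent.fpqc_specMap k L)

/-- **`Y` is reduced if `Y ×_k Spec L` is** (reducedness descends along the flat surjective projection `Y ×_k Spec L → Y`; the tree's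
`Morphisms.isReduced_of_flat_of_surjective`, Stacks 033E / EGA IV₂ 2.1.13).  For base change along a ring homomorphism see also
`isReduced_of_baseChangeHom` (`Motives/BaseChangeHomDescent`). [cite: GrothendieckDieudonne1965, Prop. 2.1.13] -/
theorem isReduced_of_baseChange (h : IsReduced (GaloisDescent.bc L Y)) : IsReduced Y.left :=
  Literature.AlgebraicGeometry.Morphisms.isReduced_of_flat_of_surjective (pullback.fst Y.hom (bcSpec k L))

end DescentOfProperties

/-! ## §2 The covering hypothesis for projective schemes -/

section Cover

variable {k : Type u} [Field k] (L : Type u) [Field L] [Algebra k L]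

/-- **Every point of a projective `L`-scheme with a `Gal(L/k)`-action lies in a `Gal`-stable affine open** (finite sets of points of a
projective scheme lie in affine opens — graded prime avoidance, `IsProjectiveOver.finiteSubsetsInAffineOpens` — then intersect over the
orbit, `GaloisDescentScheme.forall_exists_stableAffineOpen`): the covering hypothesis `hcov` of Galois descent, discharged.
[cite: Milne1986JacobianVarieties, §3, proof of Prop. 3.2] [cite: MumfordAV1970, §7 Thm. p. 66 (hypothesis)] -/
theorem cov_of_isProjectiveOver [FiniteDimensional k L] (Y : SchemeOver L) [IsSeparated Y.hom] (hproj : IsProjectiveOver Y)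
    (ρ : ActionOver (Y.hom ≫ bcSpec k L) (L ≃ₐ[k] L)) : ∀ x : Y.left, ∃ O : ρ.StableAffineOpens, x ∈ O.1 := by
  haveI : Y.left.IsSeparated := ⟨by rw [← terminal.comp_from Y.hom]; infer_instance⟩
  refine GaloisDescentScheme.forall_exists_stableAffineOpen ρ fun S ↦ ?_
  obtain ⟨W, hW, hS⟩ := (IsProjectiveOver.finiteSubsetsInAffineOpens hproj).exists_open S
  haveI := hW
  have hWa : IsAffine (W : Scheme.{u}) := isAffine_of_isAffineHom (W.ι ≫ Y.hom)
  exact ⟨W, hWa, fun x hx ↦ hS x hx⟩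

end Cover

/-! ## §3 The input datum: a semilinear Galois action on a diagram of `L`-schemes, natural in the index -/

namespace GaloisDescentFunctor

variable (k : Type u) [Field k] {L : Type u} [Field L] [Algebra k L]
variable {J : Type w} [Category.{v} J] (X : J ⥤ SchemeOver L)

/-- **A descent datum on a diagram of `L`-schemes**: `Gal(L/k)` acting on every `X j` by `k`-automorphisms (`ρ`), SEMILINEARLY
(`semilinear`: `ρ_j σ` covers `Spec σ⁻¹` on `Spec L`, the convention of `GaloisDescent.gal`), NATURALLY in `j` (`natural`: the
transition maps are equivariant), with the covering hypothesis of Galois descent of schemes (`cov`: every point lies in a `Gal`-stable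
affine open — automatic for projective `X j`, `cov_of_isProjectiveOver`) and the regularity the tree's descent of morphisms asks for
(`locallyOfFiniteType`, `separated`, `reduced`).  A HYPOTHESIS structure (data + properties supplied by the consumer).
[cite: GortzWedhorn2020, §(14.20), Thm. 14.83 and Cor. 14.85] -/
structure Datum where
  /-- the Galois action on `X j` by automorphisms over `Spec k` -/
  ρ : ∀ j : J, ActionOver ((X.obj j).hom ≫ bcSpec k L) (L ≃ₐ[k] L)
  /-- semilinearity: `ρ_j σ` covers `Spec σ⁻¹` on `Spec L` -/
  semilinear : ∀ (j : J) (σ : L ≃ₐ[k] L), ((ρ j).aut σ).hom ≫ (X.obj j).hom = (X.obj j).hom ≫ specAut L σ⁻¹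
  /-- naturality: the transition maps of the diagram are `Gal`-equivariant -/
  natural : ∀ ⦃i j : J⦄ (f : i ⟶ j) (σ : L ≃ₐ[k] L),
    ((ρ i).aut σ).hom ≫ (X.map f).left = (X.map f).left ≫ ((ρ j).aut σ).hom
  /-- covering hypothesis: every point of `X j` lies in a `Gal`-stable open, affine over `Spec k` -/
  cov : ∀ (j : J) (x : (X.obj j).left), ∃ O : (ρ j).StableAffineOpens, x ∈ O.1
  /-- `X j → Spec L` is locally of finite type -/
  locallyOfFiniteType : ∀ j : J, LocallyOfFiniteType (X.obj j).hom
  /-- `X j → Spec L` is separated -/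
  separated : ∀ j : J, IsSeparated (X.obj j).hom
  /-- `X j` is reduced -/
  reduced : ∀ j : J, IsReduced (X.obj j).left

namespace Datum

variable {k X} (L)
variable (D : Datum k X) [FiniteDimensional k L]

/-! ## §4 Object-wise descent and the equivariant identifications -/

/-- **The `k`-form `X₀ j := (X j) / Gal(L/k)`** of the `j`-th object (`GaloisDescentScheme.descended`).
[cite: GortzWedhorn2020, Thm. 14.83 and Cor. 14.85] -/
def obj₀ (j : J) : SchemeOver k :=
  haveI := D.separated j
  GaloisDescentScheme.descended L (D.ρ j)

variable [IsGalois k L]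

/-- **`X j ≅ (X₀ j) ×_k Spec L` over `L`** (`GaloisDescentScheme.isoBaseChangeOver`). [cite: GortzWedhorn2020, Thm. 14.83 and Cor. 14.85] -/
def iso (j : J) : X.obj j ≅ (bcFunctor k L).obj (D.obj₀ L j) :=
  haveI := D.separated j
  GaloisDescentScheme.isoBaseChangeOver L (X.obj j).hom (D.ρ j) rfl (D.semilinear j) (D.cov j)

/-- The identification is `Gal`-equivariant: `ρ_j σ ≫ e_j = e_j ≫ (1 × Spec σ⁻¹)`. [cite: GortzWedhorn2020, §(14.20) and Thm. 14.83] -/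
@[reassoc]
theorem aut_hom_iso_hom_left (j : J) (σ : L ≃ₐ[k] L) :
    ((D.ρ j).aut σ).hom ≫ (D.iso L j).hom.left = (D.iso L j).hom.left ≫ GaloisDescent.gal L (D.obj₀ L j) σ :=
  haveI := D.separated j
  GaloisDescentScheme.aut_hom_isoBaseChange_hom L (X.obj j).hom (D.ρ j) rfl (D.semilinear j) (D.cov j) σ

/-- Equivariance for the inverse: `(1 × Spec σ⁻¹) ≫ e_j⁻¹ = e_j⁻¹ ≫ ρ_j σ`. [cite: GortzWedhorn2020, §(14.20) and Thm. 14.83] -/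
@[reassoc]
theorem gal_iso_inv_left (j : J) (σ : L ≃ₐ[k] L) :
    GaloisDescent.gal L (D.obj₀ L j) σ ≫ (D.iso L j).inv.left = (D.iso L j).inv.left ≫ ((D.ρ j).aut σ).hom := by
  have h1 : (D.iso L j).hom.left ≫ (D.iso L j).inv.left = 𝟙 _ := by
    rw [← Over.comp_left, Iso.hom_inv_id, Over.id_left]
  haveI : IsIso (D.iso L j).hom.left := inferInstance
  rw [← cancel_epi (D.iso L j).hom.left, reassoc_of% h1, ← D.aut_hom_iso_hom_left_assoc L j σ, h1, Category.comp_id]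

/-! ## §5 The descended objects satisfy the hypotheses of descent of morphisms -/

/-- `(X₀ j) ×_k Spec L ≅ X j` is reduced. [cite: GortzWedhorn2020, Thm. 14.83 and Cor. 14.85] -/
theorem isReduced_bc_obj₀ (j : J) : IsReduced (GaloisDescent.bc L (D.obj₀ L j)) := by
  haveI := D.reduced j
  haveI : IsIso (D.iso L j).inv.left := inferInstance
  exact isReduced_of_isOpenImmersion (D.iso L j).inv.left

/-- `X₀ j → Spec k` is locally of finite type (descent along `Spec L → Spec k`, §1). [cite: GortzWedhorn2020, Prop. 14.53 (1) with Example 14.55] -/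
theorem locallyOfFiniteType_obj₀ (j : J) : LocallyOfFiniteType (D.obj₀ L j).hom := by
  refine locallyOfFiniteType_of_baseChange L (D.obj₀ L j) ?_
  rw [← Over.w (D.iso L j).inv]
  haveI := D.locallyOfFiniteType j
  infer_instance

/-- `X₀ j → Spec k` is separated (descent along `Spec L → Spec k`, §1). [cite: GortzWedhorn2020, Prop. 14.51 (6) with Example 14.55] -/
theorem isSeparated_obj₀ (j : J) : IsSeparated (D.obj₀ L j).hom := by
  refine isSeparated_of_baseChange L (D.obj₀ L j) ?_
  rw [← Over.w (D.iso L j).inv]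
  haveI := D.separated j
  infer_instance

/-! ## §6 Descent of the transition maps -/

/-- The transition map `X i → X j` transported to `(X₀ i)_L → (X₀ j)_L`. [cite: GortzWedhorn2020, Thm. 14.72 (1)] -/
def mapL {i j : J} (f : i ⟶ j) : (bcFunctor k L).obj (D.obj₀ L i) ⟶ (bcFunctor k L).obj (D.obj₀ L j) :=
  (D.iso L i).inv ≫ X.map f ≫ (D.iso L j).hom

/-- Unfolding of `mapL`. [cite: GortzWedhorn2020, Thm. 14.72 (1)] -/
theorem mapL_def {i j : J} (f : i ⟶ j) : D.mapL L f = (D.iso L i).inv ≫ X.map f ≫ (D.iso L j).hom := rfl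

/-- `mapL` respects identities. [cite: GortzWedhorn2020, Thm. 14.72 (1)] -/
theorem mapL_id (j : J) : D.mapL L (𝟙 j) = 𝟙 _ := by
  rw [mapL_def, X.map_id, Category.id_comp, Iso.inv_hom_id]

/-- `mapL` respects composition. [cite: GortzWedhorn2020, Thm. 14.72 (1)] -/
theorem mapL_comp {i j l : J} (f : i ⟶ j) (g : j ⟶ l) : D.mapL L (f ≫ g) = D.mapL L f ≫ D.mapL L g := by
  simp only [mapL_def, X.map_comp, Category.assoc, Iso.hom_inv_id_assoc]

/-- **The transported transition maps commute with the Galois automorphisms** (naturality of `ρ` and equivariance of the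
identifications). [cite: GortzWedhorn2020, §(14.20) and Thm. 14.72 (1)] -/
@[reassoc]
theorem gal_comp_mapL_left {i j : J} (f : i ⟶ j) (σ : L ≃ₐ[k] L) :
    GaloisDescent.gal L (D.obj₀ L i) σ ≫ (D.mapL L f).left = (D.mapL L f).left ≫ GaloisDescent.gal L (D.obj₀ L j) σ := by
  simp only [mapL_def, Over.comp_left, Category.assoc]
  rw [D.gal_iso_inv_left_assoc L i σ, reassoc_of% (D.natural f σ), D.aut_hom_iso_hom_left L j σ]

/-- **The descended transition map `X₀ i → X₀ j`** (Galois descent of the equivariant `L`-morphism `mapL f`, Görtz–Wedhorn I,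
Thm. 14.72 (1): `GaloisDescent.descentOver`). [cite: GortzWedhorn2020, Thm. 14.72 (1)] -/
def map₀ {i j : J} (f : i ⟶ j) : D.obj₀ L i ⟶ D.obj₀ L j :=
  haveI := D.isReduced_bc_obj₀ L i
  haveI := D.locallyOfFiniteType_obj₀ L i
  haveI := D.isSeparated_obj₀ L j
  GaloisDescent.descentOver L (D.mapL L f) (D.gal_comp_mapL_left L f)

/-- **The base change of the descended transition map is the transported one**: `(map₀ f)_L = e_i⁻¹ ≫ X.map f ≫ e_j`.
[cite: GortzWedhorn2020, Thm. 14.72 (1)] -/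
theorem bcFunctor_map_map₀ {i j : J} (f : i ⟶ j) : (bcFunctor k L).map (D.map₀ L f) = D.mapL L f := by
  haveI := D.isReduced_bc_obj₀ L i
  haveI := D.locallyOfFiniteType_obj₀ L i
  haveI := D.isSeparated_obj₀ L j
  unfold map₀
  exact GaloisDescent.bcFunctor_map_descentOver L (D.mapL L f) (D.gal_comp_mapL_left L f)

/-- **Uniqueness of the descended transition map**: any `k`-morphism `X₀ i → X₀ j` whose base change is the transported transition
map is `map₀ f` (base change along `Spec L → Spec k` is faithful). [cite: GortzWedhorn2020, Thm. 14.72 (1)] -/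
theorem map₀_unique {i j : J} (f : i ⟶ j) (g : D.obj₀ L i ⟶ D.obj₀ L j) (hg : (bcFunctor k L).map g = D.mapL L f) :
    g = D.map₀ L f :=
  bcFunctor_map_injective L (hg.trans (D.bcFunctor_map_map₀ L f).symm)

/-- `map₀` respects identities (uniqueness of descent). [cite: GortzWedhorn2020, Thm. 14.72 (1)] -/
theorem map₀_id (j : J) : D.map₀ L (𝟙 j) = 𝟙 (D.obj₀ L j) :=
  (D.map₀_unique L (𝟙 j) (𝟙 _) (by rw [CategoryTheory.Functor.map_id, mapL_id])).symm

/-- `map₀` respects composition (uniqueness of descent). [cite: GortzWedhorn2020, Thm. 14.72 (1)] -/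
theorem map₀_comp {i j l : J} (f : i ⟶ j) (g : j ⟶ l) : D.map₀ L (f ≫ g) = D.map₀ L f ≫ D.map₀ L g :=
  (D.map₀_unique L (f ≫ g) (D.map₀ L f ≫ D.map₀ L g)
    (by rw [CategoryTheory.Functor.map_comp, bcFunctor_map_map₀, bcFunctor_map_map₀, mapL_comp])).symm

/-! ## §7 The descended functor and the natural equivariant identification -/

/-- **The descended diagram `X₀ : J ⥤ SchemeOver k`**: `j ↦ (X j)/Gal`, `f ↦` the descent of `e_i⁻¹ ≫ X.map f ≫ e_j`; a functor by
uniqueness of descended morphisms. [cite: GortzWedhorn2020, Thm. 14.72 (1), Thm. 14.83 and Cor. 14.85] -/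
def descendedFunctor : J ⥤ SchemeOver k where
  obj j := D.obj₀ L j
  map f := D.map₀ L f
  map_id j := D.map₀_id L j
  map_comp f g := D.map₀_comp L f g

/-- The objects of the descended functor (by `rfl`). [cite: GortzWedhorn2020, Thm. 14.83 and Cor. 14.85] -/
theorem descendedFunctor_obj (j : J) : (D.descendedFunctor L).obj j = D.obj₀ L j := rfl

/-- The maps of the descended functor (by `rfl`). [cite: GortzWedhorn2020, Thm. 14.72 (1)] -/
theorem descendedFunctor_map {i j : J} (f : i ⟶ j) : (D.descendedFunctor L).map f = D.map₀ L f := rfl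

/-- **The base change of the descended diagram is the given one: `X ≅ X₀ ⋙ (· ×_k Spec L)`**, naturally in `j` (components the
identifications `e_j`; naturality = `bcFunctor_map_map₀`). [cite: GortzWedhorn2020, Thm. 14.83 and Cor. 14.85] -/
def isoBaseChange : X ≅ D.descendedFunctor L ⋙ bcFunctor k L :=
  NatIso.ofComponents (fun j ↦ D.iso L j) fun f ↦ by
    rw [Functor.comp_map, descendedFunctor_map, bcFunctor_map_map₀, mapL_def, Iso.hom_inv_id_assoc]

/-- The components of `isoBaseChange` are the identifications `e_j` (by `rfl`). [cite: GortzWedhorn2020, Thm. 14.83 and Cor. 14.85] -/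
theorem isoBaseChange_hom_app (j : J) : (D.isoBaseChange L).hom.app j = (D.iso L j).hom := rfl

/-- **The natural identification is `Gal`-equivariant**: `ρ_j σ ≫ ι_j = ι_j ≫ (1 × Spec σ⁻¹)` on underlying schemes.
[cite: GortzWedhorn2020, §(14.20), Thm. 14.83 and Cor. 14.85] -/
theorem aut_hom_isoBaseChange_hom_app_left (j : J) (σ : L ≃ₐ[k] L) :
    ((D.ρ j).aut σ).hom ≫ ((D.isoBaseChange L).hom.app j).left =
      ((D.isoBaseChange L).hom.app j).left ≫ GaloisDescent.gal L ((D.descendedFunctor L).obj j) σ :=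
  D.aut_hom_iso_hom_left L j σ

/-- **Uniqueness of the descended functor structure**: a family of `k`-morphisms `g f : X₀ i → X₀ j` whose base changes
intertwine the identifications with the given transition maps IS `map₀` (so the descended diagram is determined by `X`, `ρ` and the
`k`-forms). [cite: GortzWedhorn2020, Thm. 14.72 (1)] -/
theorem eq_map₀_of_comm {i j : J} (f : i ⟶ j) (g : D.obj₀ L i ⟶ D.obj₀ L j)
    (hg : (D.iso L i).hom ≫ (bcFunctor k L).map g = X.map f ≫ (D.iso L j).hom) : g = D.map₀ L f := by
  refine D.map₀_unique L f g ?_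
  rw [mapL_def, ← hg, Iso.inv_hom_id_assoc]

end Datum

end GaloisDescentFunctor

/-! ## §8 The interface theorem (binders as pinned by the consumer) -/

/-- **Effective Galois descent, functorial in the index** (Görtz–Wedhorn I, Thm. 14.83 / Cor. 14.85 with Thm. 14.72 (1)).  Let `L / k`
be finite Galois, `X : J ⥤ SchemeOver L` a diagram of reduced `L`-schemes, separated and locally of finite type over `L`, and let
`Gal(L/k)` act on every `X j` by `k`-automorphisms (`ρ`) covering `Spec σ⁻¹` (`hρ`), the transition maps being equivariant (`hnat`),
every point lying in a `Gal`-stable affine open (`hcov`; for projective `X j` see `cov_of_isProjectiveOver`).  Then there are a diagram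
`X₀ : J ⥤ SchemeOver k` and a natural isomorphism `ι : X ≅ X₀ ⋙ (· ×_k Spec L)` carrying `ρ_j σ` to the Galois automorphism
`1 × Spec σ⁻¹` of `(X₀ j) ×_k Spec L` (`GaloisDescent.gal`) for every `j` and `σ`.
[cite: GortzWedhorn2020, §(14.20), Thm. 14.72 (1), Thm. 14.83 and Cor. 14.85] [cite: SerreLocalFields1979, Ch. X, §2] -/
theorem GaloisDescentFunctor.exists_functor_iso {k : Type u} [Field k] (L : Type u) [Field L] [Algebra k L]
    [FiniteDimensional k L] [IsGalois k L] {J : Type w} [Category.{v} J] (X : J ⥤ SchemeOver L)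
    (ρ : ∀ j : J, ActionOver ((X.obj j).hom ≫ bcSpec k L) (L ≃ₐ[k] L))
    (hρ : ∀ (j : J) (σ : L ≃ₐ[k] L), ((ρ j).aut σ).hom ≫ (X.obj j).hom = (X.obj j).hom ≫ specAut L σ⁻¹)
    (hnat : ∀ ⦃i j : J⦄ (f : i ⟶ j) (σ : L ≃ₐ[k] L),
      ((ρ i).aut σ).hom ≫ (X.map f).left = (X.map f).left ≫ ((ρ j).aut σ).hom)
    (hcov : ∀ (j : J) (x : (X.obj j).left), ∃ O : (ρ j).StableAffineOpens, x ∈ O.1)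
    (hlft : ∀ j : J, LocallyOfFiniteType (X.obj j).hom) (hsep : ∀ j : J, IsSeparated (X.obj j).hom)
    (hred : ∀ j : J, IsReduced (X.obj j).left) :
    ∃ (X₀ : J ⥤ SchemeOver k) (ι : X ≅ X₀ ⋙ bcFunctor k L),
      ∀ (j : J) (σ : L ≃ₐ[k] L),
        ((ρ j).aut σ).hom ≫ (ι.hom.app j).left = (ι.hom.app j).left ≫ GaloisDescent.gal L (X₀.obj j) σ :=
  let D : GaloisDescentFunctor.Datum k X := ⟨ρ, hρ, hnat, hcov, hlft, hsep, hred⟩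
  ⟨D.descendedFunctor L, D.isoBaseChange L, fun j σ ↦ D.aut_hom_isoBaseChange_hom_app_left L j σ⟩

/-- **The same for diagrams of PROJECTIVE `L`-schemes**, where the covering hypothesis is automatic (`cov_of_isProjectiveOver`) and
separatedness / finite type come with projectivity's closed immersion into `ℙⁿ_L` — stated with `IsProjectiveOver` plus the
regularity binders kept explicit (the tree's `IsProjectiveOver` is the bare closed-immersion predicate).
[cite: GortzWedhorn2020, Thm. 14.83 and Cor. 14.85] [cite: Milne1986JacobianVarieties, §3, proof of Prop. 3.2] -/
theorem GaloisDescentFunctor.exists_functor_iso_of_isProjectiveOver {k : Type u} [Field k] (L : Type u) [Field L] [Algebra k L]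
    [FiniteDimensional k L] [IsGalois k L] {J : Type w} [Category.{v} J] (X : J ⥤ SchemeOver L)
    (ρ : ∀ j : J, ActionOver ((X.obj j).hom ≫ bcSpec k L) (L ≃ₐ[k] L))
    (hρ : ∀ (j : J) (σ : L ≃ₐ[k] L), ((ρ j).aut σ).hom ≫ (X.obj j).hom = (X.obj j).hom ≫ specAut L σ⁻¹)
    (hnat : ∀ ⦃i j : J⦄ (f : i ⟶ j) (σ : L ≃ₐ[k] L),
      ((ρ i).aut σ).hom ≫ (X.map f).left = (X.map f).left ≫ ((ρ j).aut σ).hom)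
    (hproj : ∀ j : J, IsProjectiveOver (X.obj j))
    (hlft : ∀ j : J, LocallyOfFiniteType (X.obj j).hom) (hsep : ∀ j : J, IsSeparated (X.obj j).hom)
    (hred : ∀ j : J, IsReduced (X.obj j).left) :
    ∃ (X₀ : J ⥤ SchemeOver k) (ι : X ≅ X₀ ⋙ bcFunctor k L),
      ∀ (j : J) (σ : L ≃ₐ[k] L),
        ((ρ j).aut σ).hom ≫ (ι.hom.app j).left = (ι.hom.app j).left ≫ GaloisDescent.gal L (X₀.obj j) σ :=
  GaloisDescentFunctor.exists_functor_iso L X ρ hρ hnat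
    (fun j ↦ haveI := hsep j; cov_of_isProjectiveOver L (X.obj j) (hproj j) (ρ j)) hlft hsep hred

end Literature.AlgebraicGeometry.Motives

end
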